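import Mathlib
import HarnessLib.Audit
import Summits.PneNP.PneNP.Theorems.PstarChordBridgeBasis
import Summits.PneNP.PneNP.Theorems.PstarLiteralEdges
import Summits.PneNP.PneNP.Theorems.PstarChordBridgeAssemble

/-!
# Reading the NOR case of a terminal core: fundamental sets consist of literal edges (ROUND-24, memo §4 / §10 R7(iii)–R8)

FRONTIER range-avoidance ladder, rung F-N3, ROUND 24 (cell `pnp-ideate`, planner memo `r24/CORE-BOUND-NOTES.md` §4 ("UPSHOT … every clean edge of
`J₀` closes an alternating `σ/τ`-path"), §10 R7(iii) and R8; restricted-model proof complexity — nothing here bears on `P` versus `NP`).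

Continuation of `PstarChordBridgeBasis.regime_cases`.  Suppose the basis-changed second constraint `q = q_m` of the core's chord system is of NOR
TYPE: `q = λ_b·λ_a + 1` with `λ_b = P(·, b) + c_b`, `λ_a = P(·, a) + c_a`, `P = polarDir`, `P(a, b) = 1` — the data returned by the (NOR) case of
`forced_chord_cases_dir` for any one chord; it is a property of `q` alone, so it then governs ALL chords:

* `nor_ideal` — **(★★) + (b1) uniformly**: every chord-minimal chord `e ∈ N` has `Q_{D e} + γ_e + 1 = (λ_b + 1)·m₁ + (λ_a + 1)·m₂` with `m₁, m₂`
  affine (`PstarChordSystem.star_star` on the basis-changed system puts `Q_{D e} + γ_e + 1` in the ideal of the flat `Z(q) = {λ_b = λ_a = 1}`;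
  `PstarCubeIdeals.exists_affine_of_codimTwo` with the dual directions `a, b`);
* `and_meets_support` — the output-family form of `PstarLiteralEdges.edge_meets_support`: if the AND-sum of a family `D` is
  `μ₁ m₁ + μ₂ m₂ + κ` (all affine) then every output of `D` has an AND variable in the support of the linear part of `μ₁` or `μ₂`;
* `lit_of_nor` — hence **every output of every fundamental set `D e` is a LITERAL EDGE** for the literal set
  `Lit = {c : P(e_c, b) = 1 ∨ P(e_c, a) = 1}`;
* `litChain_of_nor` — with `PstarChordBridgeAssemble.ends_connected_of_even` (the XOR ends of a chord are joined inside its fundamental set):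
  the ends of every chord-minimal chord are joined by a chain of literal edges — the shape of the chord clause of `PstarLitNorCore.LitNorStructure`,
  with the literal SET `Lit` in place of a literal PAIR `{σ, τ}` (single literals = memo O5 / §4 bundle argument, not done here).
-/

set_option linter.dupNamespace false -- `Summit.PneNP.PneNP.…`: summit = sub-problem name (D-0017 single-conjunct layout)

open Finset Module Literature.Computability.Complexity
open Summit.PneNP.PneNP.Theorems.PstarFibrePolys (bit)
open Summit.PneNP.PneNP.Theorems.PstarTyped (Typed)
open Summit.PneNP.PneNP.Theorems.PstarSALevel (varSet bdry BoundaryExpanding SimpleOverlap)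
open Summit.PneNP.PneNP.Theorems.PstarCubeIdeals (IsAffineFn IsQuadFn isAffineFn_of_linear exists_affine_of_codimTwo)
open Summit.PneNP.PneNP.Theorems.PstarProductRank (qform polar)
open Summit.PneNP.PneNP.Theorems.PstarPathRank (AndAdj polar_basis polar_self_and polar_symm_and)
open Summit.PneNP.PneNP.Theorems.PstarLiteralEdges (polar_eq_zero_of_linParts)
open Summit.PneNP.PneNP.Theorems.PstarReadSumset (V2)
open Summit.PneNP.PneNP.Theorems.PstarXorElimination (pdeg)
open Summit.PneNP.PneNP.Theorems.PstarXCore (xpair mem_xpair)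
open Summit.PneNP.PneNP.Theorems.PstarChordSystem (ChordSystem)
open Summit.PneNP.PneNP.Theorems.PstarChordSystemMap (mapSys toX mapSys_u U1_package)
open Summit.PneNP.PneNP.Theorems.PstarChordBridgeTools
open Summit.PneNP.PneNP.Theorems.PstarChordBridge
open Summit.PneNP.PneNP.Theorems.PstarChordBridgeFundamental (xpdeg_insert odd_of_end mem_xpair_of_odd exists_mem_of_odd)
open Summit.PneNP.PneNP.Theorems.PstarChordBridgeForcing
open Summit.PneNP.PneNP.Theorems.PstarChordBridgeBasis
open Summit.PneNP.PneNP.Theorems.PstarChordBridgeAssemble (reflTransGen_of_forall ends_connected_of_even)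

namespace Summit.PneNP.PneNP.Theorems.PstarChordBridgeNor

variable {n m : ℕ}

/-! ## Every output of an AND-sum in "two-literal form" meets the literal supports -/

/-- **Output-family form of `edge_meets_support`.**  Pure instance with simple overlaps; if `Q_D = μ₁ m₁ + μ₂ m₂ + κ` with all four factors affine,
then every output `j ∈ D` has an AND variable `c` with `μ₁(e_c) ≠ μ₁(0)` or `μ₂(e_c) ≠ μ₂(0)`. -/
theorem and_meets_support (I : LocalMap 4 n m) (hI : I.IsPure xorAndPred) (hS : SimpleOverlap I) {D : Finset (Fin m)}
    {μ₁ μ₂ m₁ m₂ : (Fin n → ZMod 2) → ZMod 2} (h₁ : IsAffineFn μ₁) (h₂ : IsAffineFn μ₂) (hm₁ : IsAffineFn m₁) (hm₂ : IsAffineFn m₂)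
    {κ : ZMod 2} (hQ : ∀ x, qform D (fun j => I.vars j 2) (fun j => I.vars j 3) x = μ₁ x * m₁ x + μ₂ x * m₂ x + κ) {j : Fin m} (hj : j ∈ D) :
    ∃ s : Fin 4, 2 ≤ s.val ∧ (μ₁ (Pi.single (I.vars j s) 1) ≠ μ₁ 0 ∨ μ₂ (Pi.single (I.vars j s) 1) ≠ μ₂ 0) := by
  classical
  by_contra hno
  push Not at hno
  obtain ⟨h21, h22⟩ := hno 2 (by decide)
  obtain ⟨h31, h32⟩ := hno 3 (by decide)
  have h0 := polar_eq_zero_of_linParts h₁ h₂ hm₁ hm₂ hQ h21 h31 h22 h32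
  have hadd := qform_add' I D (Pi.single (I.vars j 2) 1) (Pi.single (I.vars j 3) 1)
  rw [polar_basis I hI hS D, if_pos ⟨j, hj, Or.inl ⟨rfl, rfl⟩⟩] at hadd
  rw [hadd] at h0
  generalize qform D (fun j => I.vars j 2) (fun j => I.vars j 3) (Pi.single (I.vars j 2) (1 : ZMod 2)) = s at h0
  generalize qform D (fun j => I.vars j 2) (fun j => I.vars j 3) (Pi.single (I.vars j 3) (1 : ZMod 2)) = s' at h0
  generalize qform D (fun j => I.vars j 2) (fun j => I.vars j 3) (0 : Fin n → ZMod 2) = s₀ at h0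
  revert s s' s₀ h0; decide

/-! ## The NOR type governs all chords -/

/-- The literal `λ_b = P(·, b) + (q b + q 0)` of the NOR presentation. -/
def lam (I : LocalMap 4 n m) (B : BridgeData n m) (mv : V2) (b : Fin n → ZMod 2) (x : Fin n → ZMod 2) : ZMod 2 :=
  polarDir I B mv x b + (qDir I B mv b + qDir I B mv 0)

/-- `λ_b` is affine with linear part `P(·, b)`. -/
theorem isAffineFn_lam (I : LocalMap 4 n m) (B : BridgeData n m) (mv : V2) (b : Fin n → ZMod 2) : IsAffineFn (lam I B mv b) :=
  isAffineFn_of_linear ((polarDir I B mv).flip b) _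

/-- `λ_b + 1` is affine. -/
theorem isAffineFn_lam_add_one (I : LocalMap 4 n m) (B : BridgeData n m) (mv : V2) (b : Fin n → ZMod 2) :
    IsAffineFn (fun x => lam I B mv b x + 1) := by
  have h := isAffineFn_of_linear ((polarDir I B mv).flip b) (qDir I B mv b + qDir I B mv 0 + 1)
  have heq : (fun x => lam I B mv b x + 1) = fun x => (polarDir I B mv).flip b x + (qDir I B mv b + qDir I B mv 0 + 1) := by
    funext x
    change polarDir I B mv x b + (qDir I B mv b + qDir I B mv 0) + 1 = polarDir I B mv x b + (qDir I B mv b + qDir I B mv 0 + 1)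
    ring
  rw [heq]
  exact h

/-- `polarDir` is alternating. -/
theorem polarDir_self (I : LocalMap 4 n m) (B : BridgeData n m) (mv : V2) (x : Fin n → ZMod 2) : polarDir I B mv x x = 0 := by
  simp only [polarDir, freePolar, LinearMap.add_apply, LinearMap.smul_apply, smul_eq_mul, polar_self_and, mul_zero, add_zero]

/-- `polarDir` is symmetric. -/
theorem polarDir_comm (I : LocalMap 4 n m) (B : BridgeData n m) (mv : V2) (x w : Fin n → ZMod 2) :
    polarDir I B mv x w = polarDir I B mv w x := by
  simp only [polarDir, freePolar, LinearMap.add_apply, LinearMap.smul_apply, smul_eq_mul]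
  rw [polar_symm_and I B.T₁ x w, polar_symm_and I (freeMon I B.N B.G₁) x w, polar_symm_and I B.T₂ x w,
    polar_symm_and I (freeMon I B.N B.G₂) x w]

/-- Translating the literal `λ_b` by `v` adds `P(v, b)`. -/
theorem lam_add (I : LocalMap 4 n m) (B : BridgeData n m) (mv : V2) (b x v : Fin n → ZMod 2) :
    lam I B mv b (x + v) = lam I B mv b x + polarDir I B mv v b := by
  simp only [lam, LinearMap.map_add, LinearMap.add_apply]
  ring

/-- **NOR type governs all chords.**  If `q_m = λ_b λ_a + 1` with `P(a,b) = 1` (NOR type), then for every chord `e ∈ N` that is chord-minimal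
in the (U1, direction `m`) core system, `Q_{D e} + γ_e + 1 = (λ_b + 1) m₁ + (λ_a + 1) m₂` with `m₁, m₂` affine. -/
theorem nor_ideal (I : LocalMap 4 n m) {B : BridgeData n m} {mv : V2} (hm : mv ≠ 0)
    (hU1 : ∀ e a, ((sys I B).ρ e a = 0 ∨ (sys I B).ρ e a = mv) ∧ ((sys I B).ρ' e a = 0 ∨ (sys I B).ρ' e a = mv))
    (hconst : ∀ e a a', (sys I B).ρ e a = (sys I B).ρ e a' ∧ (sys I B).ρ' e a = (sys I B).ρ' e a')
    (hinf : (sys I B).Infeasible B.N) {a b : Fin n → ZMod 2} (hab : polarDir I B mv a b = 1)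
    (hq : ∀ x, qDir I B mv x = lam I B mv b x * lam I B mv a x + 1) {e : Fin m} (he : e ∈ B.N) (hM : (sys I B).ChordMinimal B.N e) :
    ∃ m₁ m₂ : (Fin n → ZMod 2) → ZMod 2, IsAffineFn m₁ ∧ IsAffineFn m₂ ∧
      ∀ x, qform (B.D e) (fun j => I.vars j 2) (fun j => I.vars j 3) x + (gam B e + 1) =
        (lam I B mv b x + 1) * m₁ x + (lam I B mv a x + 1) * m₂ x := by
  obtain ⟨hSR, hinf', hmin', hconst'⟩ := U1_package (sys I B) hinf hm hU1 hconst
  -- (★★): `e` is ON on `Z(q)`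
  have hstar := (mapSys (sys I B) (toX mv)).star_star hSR hconst' hinf' he (hmin' e hM)
  have hZ : ∀ x, lam I B mv b x + 1 = 0 → lam I B mv a x + 1 = 0 →
      qform (B.D e) (fun j => I.vars j 2) (fun j => I.vars j 3) x + (gam B e + 1) = 0 := by
    intro x h1 h2
    have e1 : ∀ s : ZMod 2, s + 1 = 0 → s = 1 := by decide
    have hqx : qDir I B mv x = 0 := by rw [hq x, e1 _ h1, e1 _ h2]; decide
    have hF : ((mapSys (sys I B) (toX mv)).F x).2 = (mapSys (sys I B) (toX mv)).t.2 := by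
      have := q_dir I B mv x
      rw [hqx] at this
      have e2 : ∀ s g : ZMod 2, s + g = 0 → s = g := by decide
      exact e2 _ _ this
    have hu := hstar x hF
    rw [mapSys_u, sys_u_eq] at hu
    have key : ∀ g Q : ZMod 2, g + Q = 1 → Q + (g + 1) = 0 := by decide
    exact key _ _ hu
  have hba : polarDir I B mv b a = 1 := by rw [polarDir_comm]; exact hab
  -- dual directions: `a` flips `λ_b + 1` and fixes `λ_a + 1`; `b` the other way round
  have h11 : ∀ x, lam I B mv b (x + a) + 1 = (lam I B mv b x + 1) + 1 := fun x => by rw [lam_add, hab]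
  have h21 : ∀ x, lam I B mv a (x + a) + 1 = lam I B mv a x + 1 := fun x => by rw [lam_add, polarDir_self, add_zero]
  have h12 : ∀ x, lam I B mv b (x + b) + 1 = lam I B mv b x + 1 := fun x => by rw [lam_add, polarDir_self, add_zero]
  have h22 : ∀ x, lam I B mv a (x + b) + 1 = (lam I B mv a x + 1) + 1 := fun x => by rw [lam_add, hba]
  have hquad : IsQuadFn (fun x => qform (B.D e) (fun j => I.vars j 2) (fun j => I.vars j 3) x + (gam B e + 1)) := by
    refine ⟨polar (B.D e) (fun j => I.vars j 2) (fun j => I.vars j 3), fun x w => ?_⟩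
    simp only
    rw [qform_add' I (B.D e) x w]
    generalize gam B e = g
    generalize qform (B.D e) (fun j => I.vars j 2) (fun j => I.vars j 3) x = t₁
    generalize qform (B.D e) (fun j => I.vars j 2) (fun j => I.vars j 3) w = t₂
    generalize qform (B.D e) (fun j => I.vars j 2) (fun j => I.vars j 3) (0 : Fin n → ZMod 2) = t₀
    generalize polar (B.D e) (fun j => I.vars j 2) (fun j => I.vars j 3) x w = p
    revert g t₁ t₂ t₀ p; decide
  exact exists_affine_of_codimTwo (f := fun x => qform (B.D e) (fun j => I.vars j 2) (fun j => I.vars j 3) x + (gam B e + 1))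
    (l₁ := fun x => lam I B mv b x + 1) (l₂ := fun x => lam I B mv a x + 1) h11 h21 h12 h22 hquad hZ (isAffineFn_lam_add_one I B mv a)

/-- The LITERAL SET of the NOR presentation `(a, b)`: AND variables on which `λ_b` or `λ_a` depends. -/
def Lit (I : LocalMap 4 n m) (B : BridgeData n m) (mv : V2) (a b : Fin n → ZMod 2) (c : Fin n) : Prop :=
  polarDir I B mv (Pi.single c 1) b = 1 ∨ polarDir I B mv (Pi.single c 1) a = 1

/-- **In the NOR type every output of every fundamental set is a literal edge.** -/
theorem lit_of_nor (I : LocalMap 4 n m) (hI : I.IsPure xorAndPred) (hS : SimpleOverlap I) {B : BridgeData n m} {mv : V2} (hm : mv ≠ 0)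
    (hU1 : ∀ e a, ((sys I B).ρ e a = 0 ∨ (sys I B).ρ e a = mv) ∧ ((sys I B).ρ' e a = 0 ∨ (sys I B).ρ' e a = mv))
    (hconst : ∀ e a a', (sys I B).ρ e a = (sys I B).ρ e a' ∧ (sys I B).ρ' e a = (sys I B).ρ' e a')
    (hinf : (sys I B).Infeasible B.N) {a b : Fin n → ZMod 2} (hab : polarDir I B mv a b = 1)
    (hq : ∀ x, qDir I B mv x = lam I B mv b x * lam I B mv a x + 1) {e : Fin m} (he : e ∈ B.N) (hM : (sys I B).ChordMinimal B.N e)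
    {j : Fin m} (hj : j ∈ B.D e) : ∃ s : Fin 4, 2 ≤ s.val ∧ Lit I B mv a b (I.vars j s) := by
  obtain ⟨m₁, m₂, hm₁, hm₂, hQ⟩ := nor_ideal I hm hU1 hconst hinf hab hq he hM
  have hQ' : ∀ x, qform (B.D e) (fun j => I.vars j 2) (fun j => I.vars j 3) x =
      (lam I B mv b x + 1) * m₁ x + (lam I B mv a x + 1) * m₂ x + (gam B e + 1) := fun x => by
    have key : ∀ Q g R : ZMod 2, Q + (g + 1) = R → Q = R + (g + 1) := by decide
    exact key _ _ _ (hQ x)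
  obtain ⟨s, hs, h⟩ := and_meets_support I hI hS (isAffineFn_lam_add_one I B mv b) (isAffineFn_lam_add_one I B mv a) hm₁ hm₂ hQ' hj
  refine ⟨s, hs, ?_⟩
  have key : ∀ c v : Fin n → ZMod 2, (lam I B mv c v + 1 ≠ lam I B mv c 0 + 1) ↔ polarDir I B mv v c = 1 := by
    intro c v
    have := lam_add I B mv c 0 v
    rw [zero_add] at this
    rw [this]
    generalize lam I B mv c 0 = t; generalize polarDir I B mv v c = p
    revert t p; decide
  rcases h with h | h
  · exact Or.inl ((key b _).1 h)
  · exact Or.inr ((key a _).1 h)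

/-! ## Literal chains between the ends of a chord -/

/-- **NOR type: the XOR ends of every chord-minimal chord are joined by a chain of LITERAL outputs of its fundamental set** — the chord clause of
`PstarLitNorCore.LitNorStructure`, with the literal set `Lit` in place of a literal pair. -/
theorem litChain_of_nor (I : LocalMap 4 n m) (hI : I.IsPure xorAndPred) (hS : SimpleOverlap I) {B : BridgeData n m} (hW : B.WF I)
    {mv : V2} (hm : mv ≠ 0)
    (hU1 : ∀ e a, ((sys I B).ρ e a = 0 ∨ (sys I B).ρ e a = mv) ∧ ((sys I B).ρ' e a = 0 ∨ (sys I B).ρ' e a = mv))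
    (hconst : ∀ e a a', (sys I B).ρ e a = (sys I B).ρ e a' ∧ (sys I B).ρ' e a = (sys I B).ρ' e a')
    (hinf : (sys I B).Infeasible B.N) {a b : Fin n → ZMod 2} (hab : polarDir I B mv a b = 1)
    (hq : ∀ x, qDir I B mv x = lam I B mv b x * lam I B mv a x + 1) {e : Fin m} (he : e ∈ B.N) (hM : (sys I B).ChordMinimal B.N e) :
    Relation.ReflTransGen
      (fun x y => ∃ j ∈ B.D e, (∃ s : Fin 4, 2 ≤ s.val ∧ Lit I B mv a b (I.vars j s)) ∧ x ∈ xpair I j ∧ y ∈ xpair I j)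
      (I.vars e 0) (I.vars e 1) := by
  have heD : e ∉ B.D e := fun h => (mem_sdiff.1 (hW.hD e he h)).2 he
  exact reflTransGen_of_forall I (fun j hj => lit_of_nor I hI hS hm hU1 hconst hinf hab hq he hM hj)
    (ends_connected_of_even I hI heD (hW.hDeven e he))

end Summit.PneNP.PneNP.Theorems.PstarChordBridgeNor
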